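import Summits.Ventures.LatticeQCDFlow.Scoring.UNWilsonLoopTraceSqMoment2D
import HarnessLib

/-!
# The exact variance of two-dimensional `U(N)` Wilson loops: `Var_β(N⁻¹Re tr W_{R×T})` in closed form

HONEST FRAMING: exact (Metropolis-corrected) sampling algorithms for lattice gauge theory;
figures of merit are autocorrelation/cost numbers at stated couplings and volumes; no
continuum-physics claim.

Venture `LatticeQCDFlow` (cell pub-lqcd), sub-topic `Scoring`; FANOUT row 5 (`s0-sun-a`), GEN-21.
NEW WORK of the cell (placement rule).  Assembly of GEN-21's two quadratic moments of the free-boundary `R × T`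
Wilson loop of two-dimensional `U(N)` lattice Yang–Mills (`N ≥ 2`, every real `β`, weight `e^{−β(N − Re tr U_p)}`,
`R + 1 ≤ L`, `T + 1 ≤ L` in `(ℤ/L)²`) — `⟨|tr W|²⟩ = 1 + (N²−1)·P_adj^{RT}` (`UNWilsonLoopSecondMoment2D`) and
`⟨(tr W)²⟩ = d_S·P_S^{RT} + d_A·P_A^{RT}` (`UNWilsonLoopTraceSqMoment2D`) — with `(Re z)² = (|z|² + Re z²)/2`:

* **`unitary_open_re_trace_sq_wilsonLoop_eq`** — `⟨(Re tr W)²⟩_β = ½·(1 + (N²−1)·P_adj^{RT} + Re(d_S·P_S^{RT} + d_A·P_A^{RT}))`;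
* **`unitary_open_wilsonLoop_variance_eq`** — for theory-2's observable `W = N⁻¹Re tr W_{R×T}` (whose mean is
  `P_N(β)^{RT}`, GEN-18): `⟨W²⟩_β − ⟨W⟩_β² = (1 + (N²−1)·P_adj^{RT} + Re(d_S·P_S^{RT} + d_A·P_A^{RT}))/(2N²) − P_N^{2RT}`.

Here `D = det[I_{|i−j|}(β)]`, `M₂ = ∫|tr u|²e^{βRe tr u}du`, `s₁ = ∫(tr u)²e^{βRe tr u}du`, `s₂ = ∫tr(u²)e^{βRe tr u}du`,
`P_adj = (M₂/D − 1)/(N²−1)`, `P_S = (s₁+s₂)/(N(N+1)D)`, `P_A = (s₁−s₂)/(N(N−1)D)`, `d_{S/A} = N(N±1)/2`,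
`P_N = ∫N⁻¹Re tr u·e^{−β(N−Re tr u)}du / ∫e^{−β(N−Re tr u)}du`: every one-plaquette quantity is an explicit
`U(N)` integral (Bessel–Toeplitz forms in GEN-17/20).  This is THE EXACT SIGNAL-TO-NOISE LAW of Wilson-loop measurements
in two dimensions: when the three normalised plaquettes have modulus `< 1` the variance tends to the Haar value `1/(2N²)`
as `RT → ∞`, while the signal decays like `P_N^{RT}`.

No `def`, nothing cited as a fact, 0 sorry.
-/

noncomputable section

open MeasureTheory Function Finset
open Literature.MathematicalPhysics.QuantumFieldTheory
open Literature.MathematicalPhysics.QuantumLattice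
open Summit.Ventures.LatticeQCDFlow.Theory2.Lattice
open Summit.Ventures.LatticeQCDFlow.Theory2.Lattice.TwoDim
open Literature.Analysis.FunctionSpaces (besselI)

namespace Summit.Ventures.LatticeQCDFlow.Scoring

section Variance

variable {L : ℕ} [NeZero L] {N : ℕ}

/-- **`⟨(Re tr W_{R×T})²⟩_β` in closed form** (`U(N)`, `N ≥ 2`, every real `β`):
`∫ (Re tr W)² ∏_p e^{−β(N−Re tr U_p)} / ∫ ∏_p e^{−β(N−Re tr U_p)}
  = ½·((1 + (N²−1)·P_adj^{RT}) + Re(d_S·P_S^{RT} + d_A·P_A^{RT}))`. -/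
theorem unitary_open_re_trace_sq_wilsonLoop_eq (hN : 2 ≤ N) (β : ℝ) (i j : ZMod L) {R T : ℕ}
    (hR : R + 1 ≤ L) (hT : T + 1 ≤ L) :
    (∫ U, ((rectangleHolonomy U ![i, j] 0 1 R T : Matrix.unitaryGroup (Fin N) ℂ) :
          Matrix (Fin N) (Fin N) ℂ).trace.re ^ 2 *
        ∏ p ∈ (range R ×ˢ range T).image (fun q : ℕ × ℕ => (![i + q.1, j + q.2] : Site 2 L)),
          Real.exp (-(β * ((N : ℝ) - ((plaquetteHolonomy U p 0 1 : Matrix.unitaryGroup (Fin N) ℂ) :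
            Matrix (Fin N) (Fin N) ℂ).trace.re)))
        ∂(Measure.pi fun _ : Edge 2 L => haarProbability (Matrix.unitaryGroup (Fin N) ℂ))) /
      (∫ U, ∏ p ∈ (range R ×ˢ range T).image (fun q : ℕ × ℕ => (![i + q.1, j + q.2] : Site 2 L)),
          Real.exp (-(β * ((N : ℝ) - ((plaquetteHolonomy U p 0 1 : Matrix.unitaryGroup (Fin N) ℂ) :
            Matrix (Fin N) (Fin N) ℂ).trace.re)))
        ∂(Measure.pi fun _ : Edge 2 L => haarProbability (Matrix.unitaryGroup (Fin N) ℂ))) =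
      ((1 + ((N : ℝ) ^ 2 - 1) *
          (((∫ u, (‖((u : Matrix.unitaryGroup (Fin N) ℂ) : Matrix (Fin N) (Fin N) ℂ).trace‖ ^ 2 : ℝ) *
              Real.exp (β * ((u : Matrix.unitaryGroup (Fin N) ℂ) : Matrix (Fin N) (Fin N) ℂ).trace.re)
              ∂(haarProbability (Matrix.unitaryGroup (Fin N) ℂ))) /
              (Matrix.of fun i j : Fin N => besselI ((i : ℤ) - (j : ℤ)).natAbs β).det - 1) / ((N : ℝ) ^ 2 - 1)) ^ (R * T)) +
        (((N : ℂ) * (N + 1) / 2) *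
            (((∫ u, ((u : Matrix.unitaryGroup (Fin N) ℂ) : Matrix (Fin N) (Fin N) ℂ).trace ^ 2 *
                (Real.exp (β * ((u : Matrix.unitaryGroup (Fin N) ℂ) : Matrix (Fin N) (Fin N) ℂ).trace.re) : ℂ)
                ∂(haarProbability (Matrix.unitaryGroup (Fin N) ℂ))) +
              (∫ u, (((u : Matrix.unitaryGroup (Fin N) ℂ) : Matrix (Fin N) (Fin N) ℂ) *
                ((u : Matrix.unitaryGroup (Fin N) ℂ) : Matrix (Fin N) (Fin N) ℂ)).trace *
                (Real.exp (β * ((u : Matrix.unitaryGroup (Fin N) ℂ) : Matrix (Fin N) (Fin N) ℂ).trace.re) : ℂ)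
                ∂(haarProbability (Matrix.unitaryGroup (Fin N) ℂ)))) /
              (N * (N + 1) * (((Matrix.of fun i j : Fin N => besselI ((i : ℤ) - (j : ℤ)).natAbs β).det : ℝ) : ℂ))) ^ (R * T) +
          ((N : ℂ) * (N - 1) / 2) *
            (((∫ u, ((u : Matrix.unitaryGroup (Fin N) ℂ) : Matrix (Fin N) (Fin N) ℂ).trace ^ 2 *
                (Real.exp (β * ((u : Matrix.unitaryGroup (Fin N) ℂ) : Matrix (Fin N) (Fin N) ℂ).trace.re) : ℂ)
                ∂(haarProbability (Matrix.unitaryGroup (Fin N) ℂ))) -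
              (∫ u, (((u : Matrix.unitaryGroup (Fin N) ℂ) : Matrix (Fin N) (Fin N) ℂ) *
                ((u : Matrix.unitaryGroup (Fin N) ℂ) : Matrix (Fin N) (Fin N) ℂ)).trace *
                (Real.exp (β * ((u : Matrix.unitaryGroup (Fin N) ℂ) : Matrix (Fin N) (Fin N) ℂ).trace.re) : ℂ)
                ∂(haarProbability (Matrix.unitaryGroup (Fin N) ℂ)))) /
              (N * (N - 1) * (((Matrix.of fun i j : Fin N => besselI ((i : ℤ) - (j : ℤ)).natAbs β).det : ℝ) : ℂ))) ^ (R * T)).re) / 2 := by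
  -- the two GEN-21 moments (stated before the abbreviations so that `set` rewrites them too)
  have h1 := unitary_open_normSq_trace_wilsonLoop_eq (L := L) hN β i j hR hT
  have h2 := unitary_open_trace_sq_wilsonLoop_eq (L := L) hN β i j hR hT
  have hZ := unitary_open_partitionFunction_eq (L := L) N β i j hR hT
  -- abbreviations
  set μ := (Measure.pi fun _ : Edge 2 L => haarProbability (Matrix.unitaryGroup (Fin N) ℂ)) with hμ
  set Z : ℝ := ∫ U, ∏ p ∈ (range R ×ˢ range T).image (fun q : ℕ × ℕ => (![i + q.1, j + q.2] : Site 2 L)),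
      Real.exp (-(β * ((N : ℝ) - ((plaquetteHolonomy U p 0 1 : Matrix.unitaryGroup (Fin N) ℂ) :
        Matrix (Fin N) (Fin N) ℂ).trace.re))) ∂μ with hZdef
  set A : ℝ := 1 + ((N : ℝ) ^ 2 - 1) *
          (((∫ u, (‖((u : Matrix.unitaryGroup (Fin N) ℂ) : Matrix (Fin N) (Fin N) ℂ).trace‖ ^ 2 : ℝ) *
              Real.exp (β * ((u : Matrix.unitaryGroup (Fin N) ℂ) : Matrix (Fin N) (Fin N) ℂ).trace.re)
              ∂(haarProbability (Matrix.unitaryGroup (Fin N) ℂ))) /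
              (Matrix.of fun i j : Fin N => besselI ((i : ℤ) - (j : ℤ)).natAbs β).det - 1) / ((N : ℝ) ^ 2 - 1)) ^ (R * T) with hA
  set B : ℂ := ((N : ℂ) * (N + 1) / 2) *
            (((∫ u, ((u : Matrix.unitaryGroup (Fin N) ℂ) : Matrix (Fin N) (Fin N) ℂ).trace ^ 2 *
                (Real.exp (β * ((u : Matrix.unitaryGroup (Fin N) ℂ) : Matrix (Fin N) (Fin N) ℂ).trace.re) : ℂ)
                ∂(haarProbability (Matrix.unitaryGroup (Fin N) ℂ))) +
              (∫ u, (((u : Matrix.unitaryGroup (Fin N) ℂ) : Matrix (Fin N) (Fin N) ℂ) *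
                ((u : Matrix.unitaryGroup (Fin N) ℂ) : Matrix (Fin N) (Fin N) ℂ)).trace *
                (Real.exp (β * ((u : Matrix.unitaryGroup (Fin N) ℂ) : Matrix (Fin N) (Fin N) ℂ).trace.re) : ℂ)
                ∂(haarProbability (Matrix.unitaryGroup (Fin N) ℂ)))) /
              (N * (N + 1) * (((Matrix.of fun i j : Fin N => besselI ((i : ℤ) - (j : ℤ)).natAbs β).det : ℝ) : ℂ))) ^ (R * T) +
          ((N : ℂ) * (N - 1) / 2) *
            (((∫ u, ((u : Matrix.unitaryGroup (Fin N) ℂ) : Matrix (Fin N) (Fin N) ℂ).trace ^ 2 *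
                (Real.exp (β * ((u : Matrix.unitaryGroup (Fin N) ℂ) : Matrix (Fin N) (Fin N) ℂ).trace.re) : ℂ)
                ∂(haarProbability (Matrix.unitaryGroup (Fin N) ℂ))) -
              (∫ u, (((u : Matrix.unitaryGroup (Fin N) ℂ) : Matrix (Fin N) (Fin N) ℂ) *
                ((u : Matrix.unitaryGroup (Fin N) ℂ) : Matrix (Fin N) (Fin N) ℂ)).trace *
                (Real.exp (β * ((u : Matrix.unitaryGroup (Fin N) ℂ) : Matrix (Fin N) (Fin N) ℂ).trace.re) : ℂ)
                ∂(haarProbability (Matrix.unitaryGroup (Fin N) ℂ)))) /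
              (N * (N - 1) * (((Matrix.of fun i j : Fin N => besselI ((i : ℤ) - (j : ℤ)).natAbs β).det : ℝ) : ℂ))) ^ (R * T) with hB
  have hFc : Continuous fun U : GaugeConfig 2 L (Matrix.unitaryGroup (Fin N) ℂ) =>
      ((rectangleHolonomy U ![i, j] 0 1 R T : Matrix.unitaryGroup (Fin N) ℂ) : Matrix (Fin N) (Fin N) ℂ).trace :=
    (continuous_unitaryFundamentalRep (Fin N) ℂ).matrix_trace.comp (continuous_config_rectangleHolonomy _ 0 1 R T)
  have hwc : ∀ p : Site 2 L, Continuous fun U : GaugeConfig 2 L (Matrix.unitaryGroup (Fin N) ℂ) =>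
      Real.exp (-(β * ((N : ℝ) - ((plaquetteHolonomy U p 0 1 : Matrix.unitaryGroup (Fin N) ℂ) :
        Matrix (Fin N) (Fin N) ℂ).trace.re))) := fun p =>
    Real.continuous_exp.comp ((continuous_const.mul (continuous_const.sub (Complex.continuous_re.comp
      ((continuous_unitaryFundamentalRep (Fin N) ℂ).matrix_trace.comp (continuous_config_plaquetteHolonomy p 0 1))))).neg)
  have hΨc : Continuous fun U : GaugeConfig 2 L (Matrix.unitaryGroup (Fin N) ℂ) =>
      ∏ p ∈ (range R ×ˢ range T).image (fun q : ℕ × ℕ => (![i + q.1, j + q.2] : Site 2 L)),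
        Real.exp (-(β * ((N : ℝ) - ((plaquetteHolonomy U p 0 1 : Matrix.unitaryGroup (Fin N) ℂ) :
          Matrix (Fin N) (Fin N) ℂ).trace.re))) := continuous_finsetProd _ fun p _ => hwc p
  have hΨc' : Continuous fun U : GaugeConfig 2 L (Matrix.unitaryGroup (Fin N) ℂ) =>
      ∏ p ∈ (range R ×ˢ range T).image (fun q : ℕ × ℕ => (![i + q.1, j + q.2] : Site 2 L)),
        (Real.exp (-(β * ((N : ℝ) - ((plaquetteHolonomy U p 0 1 : Matrix.unitaryGroup (Fin N) ℂ) :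
          Matrix (Fin N) (Fin N) ℂ).trace.re))) : ℂ) := continuous_finsetProd _ fun p _ => Complex.continuous_ofReal.comp (hwc p)
  -- positivity of the partition function
  have hZpos : 0 < Z := by
    rw [hZ]; exact pow_pos (mul_pos (Real.exp_pos _) (det_besselI_toeplitz_fin_pos N β)) _
  have hZc : (Z : ℂ) ≠ 0 := by exact_mod_cast hZpos.ne'
  -- clear denominators in the two moments
  have e1 := (div_eq_iff hZpos.ne').1 h1
  have e2 := (div_eq_iff hZc).1 h2
  -- pointwise split `(Re F)² Ψ = (|F|²Ψ + Re(F²Ψ))/2` and integrate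
  have hI1 : Integrable (fun U => ‖((rectangleHolonomy U ![i, j] 0 1 R T : Matrix.unitaryGroup (Fin N) ℂ) : Matrix (Fin N) (Fin N) ℂ).trace‖ ^ 2 *
      ∏ p ∈ (range R ×ˢ range T).image (fun q : ℕ × ℕ => (![i + q.1, j + q.2] : Site 2 L)),
        Real.exp (-(β * ((N : ℝ) - ((plaquetteHolonomy U p 0 1 : Matrix.unitaryGroup (Fin N) ℂ) :
          Matrix (Fin N) (Fin N) ℂ).trace.re)))) μ :=
    integrable_gaugeConfig_of_continuous ((hFc.norm.pow 2).mul hΨc)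
  have hI2c : Integrable (fun U => (((rectangleHolonomy U ![i, j] 0 1 R T : Matrix.unitaryGroup (Fin N) ℂ) : Matrix (Fin N) (Fin N) ℂ).trace) ^ 2 *
      ∏ p ∈ (range R ×ˢ range T).image (fun q : ℕ × ℕ => (![i + q.1, j + q.2] : Site 2 L)),
        (Real.exp (-(β * ((N : ℝ) - ((plaquetteHolonomy U p 0 1 : Matrix.unitaryGroup (Fin N) ℂ) :
          Matrix (Fin N) (Fin N) ℂ).trace.re))) : ℂ)) μ :=
    integrable_gaugeConfig_of_continuous ((hFc.pow 2).mul hΨc')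
  have hpt : ∀ U : GaugeConfig 2 L (Matrix.unitaryGroup (Fin N) ℂ), (((rectangleHolonomy U ![i, j] 0 1 R T : Matrix.unitaryGroup (Fin N) ℂ) : Matrix (Fin N) (Fin N) ℂ).trace).re ^ 2 *
      ∏ p ∈ (range R ×ˢ range T).image (fun q : ℕ × ℕ => (![i + q.1, j + q.2] : Site 2 L)),
        Real.exp (-(β * ((N : ℝ) - ((plaquetteHolonomy U p 0 1 : Matrix.unitaryGroup (Fin N) ℂ) :
          Matrix (Fin N) (Fin N) ℂ).trace.re))) =
      (‖((rectangleHolonomy U ![i, j] 0 1 R T : Matrix.unitaryGroup (Fin N) ℂ) : Matrix (Fin N) (Fin N) ℂ).trace‖ ^ 2 * ∏ p ∈ (range R ×ˢ range T).image (fun q : ℕ × ℕ => (![i + q.1, j + q.2] : Site 2 L)),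
        Real.exp (-(β * ((N : ℝ) - ((plaquetteHolonomy U p 0 1 : Matrix.unitaryGroup (Fin N) ℂ) :
          Matrix (Fin N) (Fin N) ℂ).trace.re))) +
      ((((rectangleHolonomy U ![i, j] 0 1 R T : Matrix.unitaryGroup (Fin N) ℂ) : Matrix (Fin N) (Fin N) ℂ).trace) ^ 2 * ∏ p ∈ (range R ×ˢ range T).image (fun q : ℕ × ℕ => (![i + q.1, j + q.2] : Site 2 L)),
        (Real.exp (-(β * ((N : ℝ) - ((plaquetteHolonomy U p 0 1 : Matrix.unitaryGroup (Fin N) ℂ) :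
          Matrix (Fin N) (Fin N) ℂ).trace.re))) : ℂ)).re) / 2 := by
    intro U
    have hre2 : ∀ z : ℂ, z.re ^ 2 = (‖z‖ ^ 2 + (z ^ 2).re) / 2 := fun z => by
      rw [Complex.sq_norm, Complex.normSq_apply]; simp only [pow_two, Complex.mul_re]; ring
    rw [← Complex.ofReal_prod, Complex.re_mul_ofReal, hre2]
    ring
  have hI2 : Integrable (fun U => ((((rectangleHolonomy U ![i, j] 0 1 R T : Matrix.unitaryGroup (Fin N) ℂ) : Matrix (Fin N) (Fin N) ℂ).trace) ^ 2 *
      ∏ p ∈ (range R ×ˢ range T).image (fun q : ℕ × ℕ => (![i + q.1, j + q.2] : Site 2 L)),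
        (Real.exp (-(β * ((N : ℝ) - ((plaquetteHolonomy U p 0 1 : Matrix.unitaryGroup (Fin N) ℂ) :
          Matrix (Fin N) (Fin N) ℂ).trace.re))) : ℂ)).re) μ :=
    integrable_gaugeConfig_of_continuous (Complex.continuous_re.comp ((hFc.pow 2).mul hΨc'))
  have hre := integral_re hI2c
  simp only [RCLike.re_to_complex] at hre
  simp_rw [hpt]
  rw [integral_div, integral_add hI1 hI2, hre, e1, e2, Complex.re_mul_ofReal]
  field_simp

/-- **THE EXACT VARIANCE OF THE MEASURED WILSON LOOP IN TWO DIMENSIONS** (`U(N)`, `N ≥ 2`, every real `β`): for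
theory-2's observable `W = N⁻¹ Re tr W_{R×T}` on the free-boundary `R × T` lattice,
`⟨W²⟩_β − ⟨W⟩_β² = (1 + (N²−1)·P_adj^{RT} + Re(d_S·P_S^{RT} + d_A·P_A^{RT}))/(2N²) − P_N^{2RT}`,
the mean `⟨W⟩_β = P_N^{RT}` being GEN-18's exact area law. -/
theorem unitary_open_wilsonLoop_variance_eq (hN : 2 ≤ N) (β : ℝ) (i j : ZMod L) {R T : ℕ}
    (hR : R + 1 ≤ L) (hT : T + 1 ≤ L) :
    haveI : NeZero N := ⟨by omega⟩
    (∫ U, wilsonLoop (unitaryFundamentalRep (Fin N) ℂ) ![i, j] 0 1 R T U ^ 2 *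
          ∏ p ∈ (range R ×ˢ range T).image (fun q : ℕ × ℕ => (![i + q.1, j + q.2] : Site 2 L)),
            Real.exp (-(β * ((N : ℝ) - ((plaquetteHolonomy U p 0 1 : Matrix.unitaryGroup (Fin N) ℂ) :
              Matrix (Fin N) (Fin N) ℂ).trace.re)))
          ∂(Measure.pi fun _ : Edge 2 L => haarProbability (Matrix.unitaryGroup (Fin N) ℂ))) /
        (∫ U, ∏ p ∈ (range R ×ˢ range T).image (fun q : ℕ × ℕ => (![i + q.1, j + q.2] : Site 2 L)),
            Real.exp (-(β * ((N : ℝ) - ((plaquetteHolonomy U p 0 1 : Matrix.unitaryGroup (Fin N) ℂ) :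
              Matrix (Fin N) (Fin N) ℂ).trace.re)))
          ∂(Measure.pi fun _ : Edge 2 L => haarProbability (Matrix.unitaryGroup (Fin N) ℂ))) -
      ((∫ U, wilsonLoop (unitaryFundamentalRep (Fin N) ℂ) ![i, j] 0 1 R T U *
          ∏ p ∈ (range R ×ˢ range T).image (fun q : ℕ × ℕ => (![i + q.1, j + q.2] : Site 2 L)),
            Real.exp (-(β * ((N : ℝ) - ((plaquetteHolonomy U p 0 1 : Matrix.unitaryGroup (Fin N) ℂ) :
              Matrix (Fin N) (Fin N) ℂ).trace.re)))
          ∂(Measure.pi fun _ : Edge 2 L => haarProbability (Matrix.unitaryGroup (Fin N) ℂ))) /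
        (∫ U, ∏ p ∈ (range R ×ˢ range T).image (fun q : ℕ × ℕ => (![i + q.1, j + q.2] : Site 2 L)),
            Real.exp (-(β * ((N : ℝ) - ((plaquetteHolonomy U p 0 1 : Matrix.unitaryGroup (Fin N) ℂ) :
              Matrix (Fin N) (Fin N) ℂ).trace.re)))
          ∂(Measure.pi fun _ : Edge 2 L => haarProbability (Matrix.unitaryGroup (Fin N) ℂ)))) ^ 2 =
      ((1 + ((N : ℝ) ^ 2 - 1) *
          (((∫ u, (‖((u : Matrix.unitaryGroup (Fin N) ℂ) : Matrix (Fin N) (Fin N) ℂ).trace‖ ^ 2 : ℝ) *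
              Real.exp (β * ((u : Matrix.unitaryGroup (Fin N) ℂ) : Matrix (Fin N) (Fin N) ℂ).trace.re)
              ∂(haarProbability (Matrix.unitaryGroup (Fin N) ℂ))) /
              (Matrix.of fun i j : Fin N => besselI ((i : ℤ) - (j : ℤ)).natAbs β).det - 1) / ((N : ℝ) ^ 2 - 1)) ^ (R * T)) +
        (((N : ℂ) * (N + 1) / 2) *
            (((∫ u, ((u : Matrix.unitaryGroup (Fin N) ℂ) : Matrix (Fin N) (Fin N) ℂ).trace ^ 2 *
                (Real.exp (β * ((u : Matrix.unitaryGroup (Fin N) ℂ) : Matrix (Fin N) (Fin N) ℂ).trace.re) : ℂ)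
                ∂(haarProbability (Matrix.unitaryGroup (Fin N) ℂ))) +
              (∫ u, (((u : Matrix.unitaryGroup (Fin N) ℂ) : Matrix (Fin N) (Fin N) ℂ) *
                ((u : Matrix.unitaryGroup (Fin N) ℂ) : Matrix (Fin N) (Fin N) ℂ)).trace *
                (Real.exp (β * ((u : Matrix.unitaryGroup (Fin N) ℂ) : Matrix (Fin N) (Fin N) ℂ).trace.re) : ℂ)
                ∂(haarProbability (Matrix.unitaryGroup (Fin N) ℂ)))) /
              (N * (N + 1) * (((Matrix.of fun i j : Fin N => besselI ((i : ℤ) - (j : ℤ)).natAbs β).det : ℝ) : ℂ))) ^ (R * T) +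
          ((N : ℂ) * (N - 1) / 2) *
            (((∫ u, ((u : Matrix.unitaryGroup (Fin N) ℂ) : Matrix (Fin N) (Fin N) ℂ).trace ^ 2 *
                (Real.exp (β * ((u : Matrix.unitaryGroup (Fin N) ℂ) : Matrix (Fin N) (Fin N) ℂ).trace.re) : ℂ)
                ∂(haarProbability (Matrix.unitaryGroup (Fin N) ℂ))) -
              (∫ u, (((u : Matrix.unitaryGroup (Fin N) ℂ) : Matrix (Fin N) (Fin N) ℂ) *
                ((u : Matrix.unitaryGroup (Fin N) ℂ) : Matrix (Fin N) (Fin N) ℂ)).trace *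
                (Real.exp (β * ((u : Matrix.unitaryGroup (Fin N) ℂ) : Matrix (Fin N) (Fin N) ℂ).trace.re) : ℂ)
                ∂(haarProbability (Matrix.unitaryGroup (Fin N) ℂ)))) /
              (N * (N - 1) * (((Matrix.of fun i j : Fin N => besselI ((i : ℤ) - (j : ℤ)).natAbs β).det : ℝ) : ℂ))) ^ (R * T)).re) /
        (2 * (N : ℝ) ^ 2) -
      ((∫ u, ((u : Matrix.unitaryGroup (Fin N) ℂ) : Matrix (Fin N) (Fin N) ℂ).trace.re / N *
            Real.exp (-(β * ((N : ℝ) - ((u : Matrix.unitaryGroup (Fin N) ℂ) : Matrix (Fin N) (Fin N) ℂ).trace.re)))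
          ∂(haarProbability (Matrix.unitaryGroup (Fin N) ℂ))) /
        (∫ u, Real.exp (-(β * ((N : ℝ) - ((u : Matrix.unitaryGroup (Fin N) ℂ) : Matrix (Fin N) (Fin N) ℂ).trace.re)))
          ∂(haarProbability (Matrix.unitaryGroup (Fin N) ℂ)))) ^ (2 * (R * T)) := by
  haveI : NeZero N := ⟨by omega⟩
  rw [unitary_openWilsonLoop_eq_plaquette_pow N β i j hR hT, ← pow_mul, mul_comm (R * T) 2]
  congr 1
  -- `wilsonLoop² = N⁻² (Re tr W)²`
  have hsq : ∀ U : GaugeConfig 2 L (Matrix.unitaryGroup (Fin N) ℂ),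
      wilsonLoop (unitaryFundamentalRep (Fin N) ℂ) ![i, j] 0 1 R T U ^ 2 *
          ∏ p ∈ (range R ×ˢ range T).image (fun q : ℕ × ℕ => (![i + q.1, j + q.2] : Site 2 L)),
            Real.exp (-(β * ((N : ℝ) - ((plaquetteHolonomy U p 0 1 : Matrix.unitaryGroup (Fin N) ℂ) :
              Matrix (Fin N) (Fin N) ℂ).trace.re)))
        = ((N : ℝ) ^ 2)⁻¹ * (((rectangleHolonomy U ![i, j] 0 1 R T : Matrix.unitaryGroup (Fin N) ℂ) :
          Matrix (Fin N) (Fin N) ℂ).trace.re ^ 2 *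
          ∏ p ∈ (range R ×ˢ range T).image (fun q : ℕ × ℕ => (![i + q.1, j + q.2] : Site 2 L)),
            Real.exp (-(β * ((N : ℝ) - ((plaquetteHolonomy U p 0 1 : Matrix.unitaryGroup (Fin N) ℂ) :
              Matrix (Fin N) (Fin N) ℂ).trace.re)))) := by
    intro U
    rw [wilsonLoop, unitaryFundamentalRep_apply]
    ring
  simp_rw [hsq]
  rw [integral_const_mul, mul_div_assoc, unitary_open_re_trace_sq_wilsonLoop_eq (L := L) hN β i j hR hT]
  have hN0 : (N : ℝ) ≠ 0 := by exact_mod_cast NeZero.ne N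
  field_simp


/-- **Sanity at `β = 0`** (pure Haar links, `N ≥ 2`, `RT ≥ 1`): the variance of `W = N⁻¹Re tr W_{R×T}` is the Haar value
`1/(2N²)` (`P_adj(0) = P_S(0) = P_A(0) = P_N(0) = 0`). -/
theorem unitary_open_wilsonLoop_variance_eq_haar (hN : 2 ≤ N) (i j : ZMod L) {R T : ℕ}
    (hR : R + 1 ≤ L) (hT : T + 1 ≤ L) (hRT : 0 < R * T) :
    haveI : NeZero N := ⟨by omega⟩
    (∫ U, wilsonLoop (unitaryFundamentalRep (Fin N) ℂ) ![i, j] 0 1 R T U ^ 2 *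
          ∏ p ∈ (range R ×ˢ range T).image (fun q : ℕ × ℕ => (![i + q.1, j + q.2] : Site 2 L)),
            Real.exp (-((0 : ℝ) * ((N : ℝ) - ((plaquetteHolonomy U p 0 1 : Matrix.unitaryGroup (Fin N) ℂ) :
              Matrix (Fin N) (Fin N) ℂ).trace.re)))
          ∂(Measure.pi fun _ : Edge 2 L => haarProbability (Matrix.unitaryGroup (Fin N) ℂ))) /
        (∫ U, ∏ p ∈ (range R ×ˢ range T).image (fun q : ℕ × ℕ => (![i + q.1, j + q.2] : Site 2 L)),
            Real.exp (-((0 : ℝ) * ((N : ℝ) - ((plaquetteHolonomy U p 0 1 : Matrix.unitaryGroup (Fin N) ℂ) :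
              Matrix (Fin N) (Fin N) ℂ).trace.re)))
          ∂(Measure.pi fun _ : Edge 2 L => haarProbability (Matrix.unitaryGroup (Fin N) ℂ))) -
      ((∫ U, wilsonLoop (unitaryFundamentalRep (Fin N) ℂ) ![i, j] 0 1 R T U *
          ∏ p ∈ (range R ×ˢ range T).image (fun q : ℕ × ℕ => (![i + q.1, j + q.2] : Site 2 L)),
            Real.exp (-((0 : ℝ) * ((N : ℝ) - ((plaquetteHolonomy U p 0 1 : Matrix.unitaryGroup (Fin N) ℂ) :
              Matrix (Fin N) (Fin N) ℂ).trace.re)))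
          ∂(Measure.pi fun _ : Edge 2 L => haarProbability (Matrix.unitaryGroup (Fin N) ℂ))) /
        (∫ U, ∏ p ∈ (range R ×ˢ range T).image (fun q : ℕ × ℕ => (![i + q.1, j + q.2] : Site 2 L)),
            Real.exp (-((0 : ℝ) * ((N : ℝ) - ((plaquetteHolonomy U p 0 1 : Matrix.unitaryGroup (Fin N) ℂ) :
              Matrix (Fin N) (Fin N) ℂ).trace.re)))
          ∂(Measure.pi fun _ : Edge 2 L => haarProbability (Matrix.unitaryGroup (Fin N) ℂ)))) ^ 2 =
      1 / (2 * (N : ℝ) ^ 2) := by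
  rw [unitary_open_wilsonLoop_variance_eq (L := L) hN 0 i j hR hT, det_besselI_toeplitz_zero]
  have hM2 : (∫ u, (‖((u : Matrix.unitaryGroup (Fin N) ℂ) : Matrix (Fin N) (Fin N) ℂ).trace‖ ^ 2 : ℝ) *
      Real.exp (0 * ((u : Matrix.unitaryGroup (Fin N) ℂ) : Matrix (Fin N) (Fin N) ℂ).trace.re)
      ∂(haarProbability (Matrix.unitaryGroup (Fin N) ℂ))) = 1 := by
    simp_rw [zero_mul, Real.exp_zero, mul_one, ← Complex.normSq_eq_norm_sq]
    exact Summit.Ventures.LatticeQCDFlow.TrivializingMaps.un_integral_normSq_trace (by omega)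
  have h1 : ∫ u, ((u : Matrix.unitaryGroup (Fin N) ℂ) : Matrix (Fin N) (Fin N) ℂ).trace ^ 2 *
      (Real.exp (0 * ((u : Matrix.unitaryGroup (Fin N) ℂ) : Matrix (Fin N) (Fin N) ℂ).trace.re) : ℂ)
      ∂(haarProbability (Matrix.unitaryGroup (Fin N) ℂ)) = 0 := by
    simp_rw [zero_mul, Real.exp_zero, Complex.ofReal_one, mul_one]
    exact Summit.Ventures.LatticeQCDFlow.TrivializingMaps.un_integral_trace_sq_eq_zero
  have h2 : ∫ u, (((u : Matrix.unitaryGroup (Fin N) ℂ) : Matrix (Fin N) (Fin N) ℂ) *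
      ((u : Matrix.unitaryGroup (Fin N) ℂ) : Matrix (Fin N) (Fin N) ℂ)).trace *
      (Real.exp (0 * ((u : Matrix.unitaryGroup (Fin N) ℂ) : Matrix (Fin N) (Fin N) ℂ).trace.re) : ℂ)
      ∂(haarProbability (Matrix.unitaryGroup (Fin N) ℂ)) = 0 := by
    simp_rw [zero_mul, Real.exp_zero, Complex.ofReal_one, mul_one]
    exact un_integral_trace_mul_self_eq_zero
  have h3 : ∫ u, ((u : Matrix.unitaryGroup (Fin N) ℂ) : Matrix (Fin N) (Fin N) ℂ).trace.re / N *
      Real.exp (-(0 * ((N : ℝ) - ((u : Matrix.unitaryGroup (Fin N) ℂ) : Matrix (Fin N) (Fin N) ℂ).trace.re)))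
      ∂(haarProbability (Matrix.unitaryGroup (Fin N) ℂ)) = 0 := by
    simp_rw [zero_mul, neg_zero, Real.exp_zero, mul_one]
    rw [integral_div, Summit.Ventures.LatticeQCDFlow.TrivializingMaps.un_integral_re_trace, zero_div]
  have h2RT : 2 * (R * T) ≠ 0 := by omega
  rw [hM2, h1, h2, h3, zero_div, zero_pow h2RT, sub_zero, div_one, sub_self, zero_div, zero_pow hRT.ne', mul_zero,
    add_zero, add_zero, sub_zero, zero_div, zero_div, zero_pow hRT.ne', mul_zero, mul_zero, add_zero, Complex.zero_re,
    add_zero]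

end Variance

end Summit.Ventures.LatticeQCDFlow.Scoring
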